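import Literature.Topology.FourManifolds.HomotopySpheresGroupLeaves
import Literature.Topology.FourManifolds.HomotopySpheresInverseProofs
import Literature.Topology.FourManifolds.HomotopySpheresInverseBoundsContractible
import Literature.Topology.FourManifolds.HomotopySpheresInverseLeaves
import Literature.Topology.FourManifolds.HomotopySpheresSumDimTwoLeaves
import Literature.AlgebraicTopology.Homotopy.WhiteheadContractibleProofs
import HarnessLib

/-!
# Kervaire–Milnor's Lemma 2.4 for every sum `Σ # (-Σ)`, from its homotopy theory alone

Topic `Literature/Topology/FourManifolds`, assembly file for the tree fact
`Literature.Topology.FourManifolds.HomotopySphere.boundsContractible_of_isOrientedConnectedSum_neg` —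
Kervaire–Milnor, *Groups of homotopy spheres I*, Ann. of Math. 77 (1963), Lemma 2.4 (p. 507): "If
`M` is a homotopy sphere, then `M # (-M)` bounds a contractible manifold", read (with Lemma 2.1)
for EVERY oriented connected sum `(Σ, o) # (Σ, -o)` of a homotopy `n`-sphere, `n ≥ 2`, and its
reverse — decomposed in `HomotopySpheresInverse.lean`. Both non-homotopy-theoretic inputs of that
decomposition are now theorems of the tree:

* the rotation construction (`bW = Σ # (-Σ)`, `W ≃ₕ Σ ∖ {p}`; `RotationBody*.lean`), discharged as
  `HomotopySphere.exists_nullCobordism_isOrientedConnectedSum_neg_holds`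
  (`HomotopySpheresInverseBoundsContractible.lean`), and
* the Palais–Cerf uniqueness of oriented connected sums (Lemma 2.1, "well defined"), by which the
  one sum bounding `W` is traded for an arbitrary one:
  `exists_diffeomorph_isOrientationPreserving_of_isOrientedConnectedSum_euclidean_holds`
  (`OrientedConnectedSumUniqueness.lean`, fed in by
  `HomotopySphere.boundsContractible_of_isOrientedConnectedSum_neg_of_exists'`,
  `HomotopySpheresGroupAssembly.lean`).

Hence the fact follows from the single homotopy-theoretic sentence of the printed proof, "and
therefore is contractible": `HomotopySphere.boundsContractible_of_isOrientedConnectedSum_neg_of_compl_singleton`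
(`HomotopySpheresInverseLeaves.lean`) derives it from `HomotopySphere.contractibleSpace_compl_singleton`
(a punctured homotopy `n`-sphere, `n ≥ 2`, is contractible) ALONE. This file pushes that reduction
down to the current leaves of the tree and sorts it by dimension — everything below is PROVED, no
named fact is introduced:

* `…_of_compl_image_ball`: Lemma 2.4 for every sum GIVEN ONLY
  `HomotopySphere.contractibleSpace_compl_image_ball` (Kosinski VI §1);
* `…_of_whitehead`: GIVEN the Whitehead–Hurewicz recognition principle
  `Literature.AlgebraicTopology.Homotopy.Manifold.contractibleSpace_of_simplyConnected_of_acyclic` (for `n ≥ 3`; general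
  position and Mayer–Vietoris for `Σ ∖ {p}` are theorems of the tree) and the classification of
  surfaces in the shape `nonemptyDiffeomorphSphere_two` (`SmoothPoincareLowDim.lean`, for `n = 2`);
  `…_of_whitehead_of_simplyConnected_two`: the same with the dimension-`2` input weakened to the
  bare fundamental-group statement that punctured homotopy `2`-spheres are simply connected
  (acyclicity of `Σ ∖ {p}` being proved for all `n ≥ 2`;
  `HomotopySphere.contractibleSpace_compl_singleton_of_whitehead_of_simplyConnected_two`);
* `…_of_three_le`: in dimensions `n ≥ 3` the recognition principle ALONE gives Lemma 2.4 for
  every sum;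
* `…_of_hurewiczSubsingleton`, `…_of_leaves`, `…_of_facts`: Lemma 2.4 for every sum from the
  finest leaves that remain named facts — Hurewicz (vanishing form `hurewicz_subsingleton`, resp.
  the printed isomorphism clause `hurewicz_iso`; Hatcher Thm. 4.32), Milnor's CW type of manifolds
  (`Manifold.exists_cwComplex_homotopyEquiv`, Milnor 1959, Cor. 1), and the dimension-`2` input
  (`nonemptyDiffeomorphSphere_two`, resp. spc4.S32 `nonemptyDiffeomorphSphere_of_mem`) — via the
  reductions of `HomotopySpheresInverseBoundsContractible.lean`;
* downstream (not in this file): with the rotation construction (vii-c) and the classification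
  of curves (`Θ₁ = 0`, `OneManifoldCircle.lean`) fed in, Kervaire–Milnor's Theorem 1.1 in
  dimensions `n ≠ 0, 3, 4` from FOUR printed leaves (classification of surfaces,
  Whitehead–Hurewicz, the homotopy theory of Lemma 2.3, Smale's h-cobordism theorem) is
  `exists_commGroup_homotopySphereClass_of_ne_three_of_fourLeaves`, and the tree's Theorem 1.1
  (`n ≠ 0, 4`, adding Perelman for `n = 3`) is
  `exists_commGroup_homotopySphereClass_of_fourLeaves_of_three` (both in
  `HomotopySpheresGroupDimOne.lean`; the weaker five- and six-leaf forms
  `…_of_ne_three_of_fiveLeaves`, `…_of_sixLeaves` that this file used to carry, with the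
  classification of curves still a hypothesis, were instances of those two and have been
  removed); the four-fact form in the spc4.S32 shape is
  `exists_commGroup_homotopySphereClass_of_fourLeaves` (`HomotopySpheresInverseLeaves.lean`).

Deliberately NOT here: `boundsContractible_of_isOrientedConnectedSum_neg_holds` itself — it is the
one-liner `…_of_compl_singleton contractibleSpace_compl_singleton_holds` once the contractibility
of punctured homotopy spheres is discharged (for `n ≥ 3`: Hurewicz + CW type, in progress in
`Literature/AlgebraicTopology/`; for `n = 2`: the classification of closed simply connected
surfaces).

## Appendix (the leaves discharged): Lemma 2.4 PROVED for `n ≥ 3`; one dimension-`2` statement left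

Since the above was written the tree PROVED the vanishing form of the Hurewicz theorem
(`Literature.AlgebraicTopology.SingularHomology.hurewicz_subsingleton_holds`,
`HurewiczVanishingProofs.lean`) and, from it, the Whitehead–Hurewicz recognition principle for
manifolds (`Literature.AlgebraicTopology.Homotopy.Manifold.contractibleSpace_of_simplyConnected_of_acyclic_holds`,
`WhiteheadContractibleProofs.lean`: weakly contractible manifolds are contractible, chart by
chart). Fed into the reductions above (appendix at the end of this file, everything PROVED, no
named fact introduced):

* `HomotopySphere.boundsContractible_of_isOrientedConnectedSum_neg_three_le` — **Kervaire–Milnor's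
  Lemma 2.4 for every sum `(Σ, o) # (Σ, -o)` of a homotopy `n`-sphere, `n ≥ 3`, with NO
  hypothesis left**; this covers every dimension in which the proof of Theorem 1.1 uses the
  lemma except `n = 2` (where `Θ₂ = 0` anyway), and gives `Σ # (-Σ) ∼ₕ Sⁿ` for `n ≥ 3` from
  Lemma 2.3 (`⇐`) alone (`isHCobordant_sphere_of_isOrientedConnectedSum_neg_three_le_of_lemma23`);
* `HomotopySphere.contractibleSpace_compl_singleton_three_le` — punctured homotopy `n`-spheres,
  `n ≥ 3`, are contractible (no hypothesis);
* the tree fact in ALL dimensions `n ≥ 2` from ONE dimension-`2` statement, in each of the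
  shapes the tree currently offers, weakest first: the contractibility
  (`…_of_two`) or mere simple connectivity (`…_of_simplyConnected_two`) of punctured homotopy
  `2`-spheres; Matsumoto's one-minimum–one-maximum theorem on closed surfaces
  (`…_of_niceMorse_two`, Matsumoto 2001, Thm. 3.35 for `m = 2`) or its cancellation step
  (`…_of_cancel_two`), through the Morse–Reeb route of `HomotopySpheresSumDimTwo.lean`;
  spc4.S24 (b) in dimension `2` (`…_of_exists_isSelfIndexing_two`); Milnor's First Cancellation
  Theorem 5.4 on a slab (`…_of_firstCancellation_slab`), Assertion 6 of its proof
  (`…_of_modelChart`) and — the finest leaf of the tree at the time of writing — the deformation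
  of the level diffeomorphism in that assertion (`…_of_levelDeformation`, Milnor 1965,
  PDF pp. 31–32); or `Θ₂ = 0` (`…_of_sphere_two`).

So `boundsContractible_of_isOrientedConnectedSum_neg_holds` is
`…_of_levelDeformation Cobordism.Milnor1965_cancellation_levelDeformation_holds` (or any of the
other forms applied to the corresponding discharge) the moment that dimension-`2` leaf lands.

## References

* M. Kervaire, J. Milnor, *Groups of homotopy spheres I*, Ann. of Math. (2) 77 (1963), 504–537:
  Lemma 2.4 and its proof (p. 507), Lemma 2.1 (p. 505), Lemma 2.3 (p. 506), proof of Thm. 1.1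
  (p. 507). doi:10.2307/1970128 [KervaireMilnorAnnals1963]
* A. Kosinski, *Differential Manifolds*, Academic Press (1993), Ch. VI §§1–2. [Kosinski1993]
* G. E. Bredon, *Topology and Geometry*, GTM 139 (1993), Ch. VII, Cor. 10.11. [Bredon1993]
* Y. Matsumoto, *An Introduction to Morse Theory*, Transl. Math. Monogr. 208, AMS (2002),
  Thm. 3.35 (pp. 119–120). [Matsumoto2001]
* J. Milnor, *Lectures on the h-cobordism theorem*, Princeton (1965), Thm. 5.4 and its proof,
  Assertion 6 (PDF pp. 27–32). [MilnorHCobordism1965]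
* A. Hatcher, *Algebraic Topology*, CUP (2002), Thm. 4.32. [HatcherAT2002]
-/

open scoped Manifold ContDiff Topology ContinuousMap
open Set Module

noncomputable section

namespace Literature.Topology.FourManifolds

namespace HomotopySphere

/-! ### Lemma 2.4 for every sum from the contractibility of punctured homotopy spheres -/

/-- **Lemma 2.4 for every sum from the contractibility of a homotopy sphere with an open disc
deleted** (`HomotopySphere.contractibleSpace_compl_image_ball`, Kosinski, *Differential Manifolds*
(1993), VI §1; it gives the punctured form by `contractibleSpace_compl_singleton_of_compl_image_ball`).
[cite: KervaireMilnorAnnals1963, Lemma 2.4 (p. 507)] -/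
theorem boundsContractible_of_isOrientedConnectedSum_neg_of_compl_image_ball
    (hKball : HomotopySphere.contractibleSpace_compl_image_ball) :
    HomotopySphere.boundsContractible_of_isOrientedConnectedSum_neg :=
  boundsContractible_of_isOrientedConnectedSum_neg_of_compl_singleton
    (HomotopySphere.contractibleSpace_compl_singleton_of_compl_image_ball hKball)

/-! ### Down to the leaves: Whitehead–Hurewicz (`n ≥ 3`) and the surfaces (`n = 2`) -/

/-- **Lemma 2.4 for every sum from the Whitehead–Hurewicz recognition principle and the
classification of surfaces.** The two remaining inputs are homotopy-theoretic resp.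
two-dimensional: (a) a simply connected acyclic manifold is contractible
(`Literature.AlgebraicTopology.Homotopy.Manifold.contractibleSpace_of_simplyConnected_of_acyclic`; Bredon 1993, VII Cor. 10.11
with Milnor 1959, Cor. 1 — used for `n ≥ 3`, where `Σ ∖ {p}` is simply connected by general
position and acyclic by Mayer–Vietoris, both proved in the tree), and (b) every closed smooth
surface homotopy equivalent to `S²` is diffeomorphic to it (`nonemptyDiffeomorphSphere_two`,
`SmoothPoincareLowDim.lean`; used for `n = 2` only). [cite: KervaireMilnorAnnals1963, Lemma 2.4 (p. 507)] -/
theorem boundsContractible_of_isOrientedConnectedSum_neg_of_whitehead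
    (hW : Literature.AlgebraicTopology.Homotopy.Manifold.contractibleSpace_of_simplyConnected_of_acyclic.{0})
    (h2 : nonemptyDiffeomorphSphere_two.{0}) :
    HomotopySphere.boundsContractible_of_isOrientedConnectedSum_neg :=
  HomotopySphere.boundsContractible_of_isOrientedConnectedSum_neg_of_exists'
    (exists_isOrientedConnectedSum_neg_boundsContractible_of_whitehead hW h2)

/-- **Punctured homotopy spheres are contractible (`n ≥ 2`) from the Whitehead–Hurewicz recognition
principle, GIVEN — for `n = 2` only — the simple connectivity of punctured homotopy `2`-spheres.**
The named fact `HomotopySphere.contractibleSpace_compl_singleton` needs, besides the recognition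
principle `Manifold.contractibleSpace_of_simplyConnected_of_acyclic`, only that `Σ ∖ {p}` is simply
connected and acyclic: acyclicity is the tree theorem
`HomotopySphere.isZero_singularHomology_compl_singleton` (Mayer–Vietoris, all `n ≥ 2`), simple
connectivity is the tree theorem `HomotopySphere.simplyConnectedSpace_compl_singleton` for `n ≥ 3`
(general position) — so in dimension `2` the residual input is the bare fundamental-group
statement `π₁(Σ ∖ {p}) = 1` for homotopy `2`-spheres (true by the classification of surfaces, and
weaker than the shape `nonemptyDiffeomorphSphere_two` used by `contractibleSpace_compl_singleton_of`).
[cite: KervaireMilnorAnnals1963, Lemma 2.4, proof (p. 507)] -/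
theorem contractibleSpace_compl_singleton_of_whitehead_of_simplyConnected_two
    (hW : Literature.AlgebraicTopology.Homotopy.Manifold.contractibleSpace_of_simplyConnected_of_acyclic.{0})
    (h2 : ∀ (S : HomotopySphere 2) (p : S.carrier), SimplyConnectedSpace ↥(({p}ᶜ : Set S.carrier))) :
    HomotopySphere.contractibleSpace_compl_singleton := by
  intro n S p hn
  change ContractibleSpace ↥(({p}ᶜ : Set S.carrier))
  rcases (show n = 2 ∨ 3 ≤ n by omega) with rfl | h3
  · haveI := h2 S p
    exact hW.of_isOpen 2 isOpen_compl_singleton fun k hk =>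
      S.isZero_singularHomology_compl_singleton le_rfl p hk
  · exact contractibleSpace_compl_singleton_of_whitehead hW h3 S p

/-- **Lemma 2.4 for every sum from the Whitehead–Hurewicz recognition principle, GIVEN — for
`n = 2` only — the simple connectivity of punctured homotopy `2`-spheres** (the weakest form of
the dimension-`2` input; `contractibleSpace_compl_singleton_of_whitehead_of_simplyConnected_two`).
[cite: KervaireMilnorAnnals1963, Lemma 2.4 (p. 507)] -/
theorem boundsContractible_of_isOrientedConnectedSum_neg_of_whitehead_of_simplyConnected_two
    (hW : Literature.AlgebraicTopology.Homotopy.Manifold.contractibleSpace_of_simplyConnected_of_acyclic.{0})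
    (h2 : ∀ (S : HomotopySphere 2) (p : S.carrier), SimplyConnectedSpace ↥(({p}ᶜ : Set S.carrier))) :
    HomotopySphere.boundsContractible_of_isOrientedConnectedSum_neg :=
  boundsContractible_of_isOrientedConnectedSum_neg_of_compl_singleton
    (contractibleSpace_compl_singleton_of_whitehead_of_simplyConnected_two hW h2)

/-- **Lemma 2.4 for every sum in dimensions `n ≥ 3`, from the Whitehead–Hurewicz recognition
principle ALONE.** For a homotopy `n`-sphere `Σ`, `n ≥ 3`, every oriented connected sum `P` of
`(Σ, o)` and `(Σ, -o)` bounds a contractible manifold, GIVEN only that simply connected acyclic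
manifolds are contractible (`Manifold.contractibleSpace_of_simplyConnected_of_acyclic`): some sum
`P₀` bounds a contractible `W` (`exists_isOrientedConnectedSum_neg_boundsContractible_of_three_le`:
the rotation body, `W ≃ₕ Σ ∖ {p}`, simply connected by general position and acyclic by
Mayer–Vietoris), and `P ≅ P₀` by the Palais–Cerf uniqueness of oriented connected sums
(`exists_diffeomorph_isOrientationPreserving_of_isOrientedConnectedSum_euclidean_holds`), along
which the null-cobordism is transported (`BoundsContractible.of_diffeomorph`). This covers every
dimension in which the proof of Theorem 1.1 invokes Lemma 2.4 except `n = 2`. (Kervaire–Milnor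
1963, Lemmas 2.1, 2.4.) [cite: KervaireMilnorAnnals1963, Lemma 2.4 (p. 507)] -/
theorem boundsContractible_of_isOrientedConnectedSum_neg_of_three_le
    (hW : Literature.AlgebraicTopology.Homotopy.Manifold.contractibleSpace_of_simplyConnected_of_acyclic.{0})
    {n : ℕ} (h3 : 3 ≤ n) (S : HomotopySphere n) (P : Type) [TopologicalSpace P] [T2Space P]
    [SecondCountableTopology P] [ChartedSpace (EuclideanSpace ℝ (Fin n)) P] [IsManifold (𝓡 n) ∞ P]
    [CompactSpace P] (oP : SmoothOrientation (𝓡 n) P)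
    (hP : IsOrientedConnectedSum S.orientation (-S.orientation) oP) : BoundsContractible n P := by
  obtain ⟨P₀, _, _, _, _, _, _, oP₀, hP₀, hB⟩ :=
    exists_isOrientedConnectedSum_neg_boundsContractible_of_three_le hW h3 S
  haveI := S.connectedSpace (by omega)
  obtain ⟨φ, -⟩ := exists_diffeomorph_isOrientationPreserving_of_isOrientedConnectedSum_euclidean_holds
    (M := S.carrier) (N := S.carrier) (P := P) (P' := P₀) hP hP₀
  exact hB.of_diffeomorph φ.symm

/-! ### The finest current leaves -/

/-- **Lemma 2.4 for every sum from the three finest leaves that remain named facts**: (a) the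
vanishing form of the Hurewicz theorem (`Literature.AlgebraicTopology.SingularHomology.hurewicz_subsingleton`, Hatcher 2002,
Thm. 4.32 at the zero group), (b) Milnor's theorem that second countable Hausdorff manifolds have
the homotopy type of CW complexes (`Literature.AlgebraicTopology.Homotopy.Manifold.exists_cwComplex_homotopyEquiv`, Milnor
1959, Cor. 1) — (a), (b) and Whitehead's contractibility criterion (proved,
`whitehead_contractibleSpace_holds`) settle every `n ≥ 3`
(`contractibleSpace_of_simplyConnected_of_acyclic_of_hurewiczSubsingleton_of_cwType`) — and (c),
for `n = 2` only, the classification of closed simply connected surfaces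
(`nonemptyDiffeomorphSphere_two`). [cite: KervaireMilnorAnnals1963, Lemma 2.4 (p. 507)] -/
theorem boundsContractible_of_isOrientedConnectedSum_neg_of_hurewiczSubsingleton
    (hH : Literature.AlgebraicTopology.SingularHomology.hurewicz_subsingleton.{0})
    (hCW : Literature.AlgebraicTopology.Homotopy.Manifold.exists_cwComplex_homotopyEquiv.{0})
    (h2 : nonemptyDiffeomorphSphere_two.{0}) :
    HomotopySphere.boundsContractible_of_isOrientedConnectedSum_neg :=
  HomotopySphere.boundsContractible_of_isOrientedConnectedSum_neg_of_exists'
    (exists_isOrientedConnectedSum_neg_boundsContractible_of_hurewiczSubsingleton hH hCW h2)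

/-- **Lemma 2.4 for every sum from the printed leaves**: the isomorphism clause of the Hurewicz
theorem (`Literature.AlgebraicTopology.SingularHomology.hurewicz_iso`, Hatcher 2002, Thm. 4.32), Milnor's CW type of
manifolds (`Manifold.exists_cwComplex_homotopyEquiv`) and the classification of surfaces
(`nonemptyDiffeomorphSphere_two`). [cite: KervaireMilnorAnnals1963, Lemma 2.4 (p. 507)] -/
theorem boundsContractible_of_isOrientedConnectedSum_neg_of_leaves
    (h432 : Literature.AlgebraicTopology.SingularHomology.hurewicz_iso.{0})
    (hCW : Literature.AlgebraicTopology.Homotopy.Manifold.exists_cwComplex_homotopyEquiv.{0})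
    (h2 : nonemptyDiffeomorphSphere_two.{0}) :
    HomotopySphere.boundsContractible_of_isOrientedConnectedSum_neg :=
  HomotopySphere.boundsContractible_of_isOrientedConnectedSum_neg_of_exists'
    (exists_isOrientedConnectedSum_neg_boundsContractible_of_leaves h432 hCW h2)

/-- The same, with the dimension-`2` input in the shape of spc4.S32
(`Literature.Topology.FourManifolds.nonemptyDiffeomorphSphere_of_mem`, of which only `n = 2` is used).
[cite: KervaireMilnorAnnals1963, Lemma 2.4 (p. 507)] -/
theorem boundsContractible_of_isOrientedConnectedSum_neg_of_facts
    (h432 : Literature.AlgebraicTopology.SingularHomology.hurewicz_iso.{0})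
    (hCW : Literature.AlgebraicTopology.Homotopy.Manifold.exists_cwComplex_homotopyEquiv.{0})
    (h32 : FourManifolds.nonemptyDiffeomorphSphere_of_mem.{0}) :
    HomotopySphere.boundsContractible_of_isOrientedConnectedSum_neg :=
  HomotopySphere.boundsContractible_of_isOrientedConnectedSum_neg_of_exists'
    (exists_isOrientedConnectedSum_neg_boundsContractible_of_facts h432 hCW h32)

/-! ## Appendix: the leaves discharged

Hurewicz (`hurewicz_subsingleton_holds`) and the Whitehead–Hurewicz recognition principle for
manifolds (`Manifold.contractibleSpace_of_simplyConnected_of_acyclic_holds`) being theorems of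
the tree, the reductions above close in dimensions `n ≥ 3`, and the fact in all dimensions
rests on one dimension-`2` statement. -/

/-! ### Dimensions `n ≥ 3`: no hypothesis left -/

/-- **Kervaire–Milnor's Lemma 2.4 for every sum, dimensions `n ≥ 3` — proved outright.** For a
homotopy `n`-sphere `Σ`, `n ≥ 3`, every closed smooth oriented `n`-manifold `(P, oP)` which is an
oriented connected sum of `(Σ, o)` and `(Σ, -o)` bounds a compact contractible smooth manifold:
`boundsContractible_of_isOrientedConnectedSum_neg_of_three_le` (rotation body `W` with
`bW = Σ # (-Σ)` and `W ≃ₕ Σ ∖ {p}`, simply connected by general position and acyclic by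
Mayer–Vietoris; Palais–Cerf uniqueness for the passage to an arbitrary sum) with its one
hypothesis, the Whitehead–Hurewicz recognition principle, discharged by
`Manifold.contractibleSpace_of_simplyConnected_of_acyclic_holds` (Hurewicz's theorem and the
contractibility of weakly contractible manifolds, both proved in the tree). (Kervaire–Milnor
1963, Lemma 2.4 with Lemma 2.1; "and therefore is contractible", p. 507.)
[cite: KervaireMilnorAnnals1963, Lemma 2.4 (p. 507)] -/
theorem boundsContractible_of_isOrientedConnectedSum_neg_three_le {n : ℕ} (h3 : 3 ≤ n)
    (S : HomotopySphere n) (P : Type) [TopologicalSpace P] [T2Space P]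
    [SecondCountableTopology P] [ChartedSpace (EuclideanSpace ℝ (Fin n)) P] [IsManifold (𝓡 n) ∞ P]
    [CompactSpace P] (oP : SmoothOrientation (𝓡 n) P)
    (hP : IsOrientedConnectedSum S.orientation (-S.orientation) oP) : BoundsContractible n P :=
  boundsContractible_of_isOrientedConnectedSum_neg_of_three_le
    Literature.AlgebraicTopology.Homotopy.Manifold.contractibleSpace_of_simplyConnected_of_acyclic_holds
    h3 S P oP hP

/-- **Punctured homotopy `n`-spheres, `n ≥ 3`, are contractible — proved outright**
(`contractibleSpace_compl_singleton_of_whitehead` with the recognition principle discharged):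
`Σ ∖ {p}` is simply connected by general position, acyclic by Mayer–Vietoris, hence
contractible. This is the sentence "and therefore is contractible" of the proof of Lemma 2.4
(Kervaire–Milnor 1963, p. 507) in dimensions `n ≥ 3`. [cite: KervaireMilnorAnnals1963, Lemma 2.4, proof (p. 507)] [cite: Kosinski1993, Ch. VI §2 Prop. 2.1] -/
theorem contractibleSpace_compl_singleton_three_le {n : ℕ} (h3 : 3 ≤ n) (S : HomotopySphere n)
    (p : S.carrier) : ContractibleSpace ↥(({p}ᶜ : Set S.carrier)) :=
  contractibleSpace_compl_singleton_of_whitehead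
    Literature.AlgebraicTopology.Homotopy.Manifold.contractibleSpace_of_simplyConnected_of_acyclic_holds
    h3 S p

/-! ### All dimensions from one dimension-`2` statement -/

/-- **The named fact `HomotopySphere.contractibleSpace_compl_singleton` (punctured homotopy
`n`-spheres are contractible, `n ≥ 2`) from its dimension-`2` instance alone**, dimensions
`n ≥ 3` being the theorem `contractibleSpace_compl_singleton_three_le`.
[cite: KervaireMilnorAnnals1963, Lemma 2.4, proof (p. 507)] -/
theorem contractibleSpace_compl_singleton_of_two
    (h2 : ∀ (S : HomotopySphere 2) (p : S.carrier), ContractibleSpace ↥(({p}ᶜ : Set S.carrier))) :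
    HomotopySphere.contractibleSpace_compl_singleton := by
  intro n S p hn
  change ContractibleSpace ↥(({p}ᶜ : Set S.carrier))
  rcases (show n = 2 ∨ 3 ≤ n by omega) with rfl | h3
  · exact h2 S p
  · exact contractibleSpace_compl_singleton_three_le h3 S p

/-- **Lemma 2.4 for every sum (all `n ≥ 2`) from the contractibility of punctured homotopy
`2`-spheres alone** (`boundsContractible_of_isOrientedConnectedSum_neg_of_compl_singleton` with
`contractibleSpace_compl_singleton_of_two`). [cite: KervaireMilnorAnnals1963, Lemma 2.4 (p. 507)] -/
theorem boundsContractible_of_isOrientedConnectedSum_neg_of_two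
    (h2 : ∀ (S : HomotopySphere 2) (p : S.carrier), ContractibleSpace ↥(({p}ᶜ : Set S.carrier))) :
    HomotopySphere.boundsContractible_of_isOrientedConnectedSum_neg :=
  boundsContractible_of_isOrientedConnectedSum_neg_of_compl_singleton
    (contractibleSpace_compl_singleton_of_two h2)

/-- **Lemma 2.4 for every sum (all `n ≥ 2`) from the simple connectivity of punctured homotopy
`2`-spheres alone** — the weakest dimension-`2` input: given `π₁(Σ ∖ {p}) = 1` for homotopy
`2`-spheres, `Σ ∖ {p}` is acyclic (Mayer–Vietoris, proved for all `n ≥ 2`) hence contractible by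
the recognition principle, now a theorem
(`boundsContractible_of_isOrientedConnectedSum_neg_of_whitehead_of_simplyConnected_two` with
`Manifold.contractibleSpace_of_simplyConnected_of_acyclic_holds`). [cite: KervaireMilnorAnnals1963, Lemma 2.4 (p. 507)] -/
theorem boundsContractible_of_isOrientedConnectedSum_neg_of_simplyConnected_two
    (h2 : ∀ (S : HomotopySphere 2) (p : S.carrier), SimplyConnectedSpace ↥(({p}ᶜ : Set S.carrier))) :
    HomotopySphere.boundsContractible_of_isOrientedConnectedSum_neg :=
  boundsContractible_of_isOrientedConnectedSum_neg_of_whitehead_of_simplyConnected_two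
    Literature.AlgebraicTopology.Homotopy.Manifold.contractibleSpace_of_simplyConnected_of_acyclic_holds h2

/-- **Lemma 2.4 for every sum from Matsumoto's one-minimum–one-maximum theorem on closed
surfaces** (`exists_isMorse_ncard_criticalSetOfIndex_eq_one 2`, Matsumoto 2002, Thm. 3.35 for
`m = 2`): on a homotopy `2`-sphere such a Morse function has no saddle, and Reeb's flow argument
contracts `Σ ∖ {p}` (`contractibleSpace_compl_singleton_two_of_niceMorse`,
`HomotopySpheresSumDimTwoLeaves.lean`). [cite: KervaireMilnorAnnals1963, Lemma 2.4 (p. 507)] [cite: Matsumoto2001, Thm. 3.35] -/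
theorem boundsContractible_of_isOrientedConnectedSum_neg_of_niceMorse_two
    (hU : exists_isMorse_ncard_criticalSetOfIndex_eq_one.{0} 2) :
    HomotopySphere.boundsContractible_of_isOrientedConnectedSum_neg :=
  boundsContractible_of_isOrientedConnectedSum_neg_of_two
    (contractibleSpace_compl_singleton_two_of_niceMorse hU)

/-- **Lemma 2.4 for every sum from the cancellation of a superfluous minimum on closed
surfaces** (`exists_isMorse_ncard_criticalSetOfIndex_zero_add_one_eq 2`, the one step of the
proof of Matsumoto's Thm. 3.35 that is not yet a theorem of the tree;
`contractibleSpace_compl_singleton_two`, `HomotopySpheresSumDimTwo.lean`). [cite: KervaireMilnorAnnals1963, Lemma 2.4 (p. 507)] [cite: Matsumoto2001, proof of Thm. 3.35] -/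
theorem boundsContractible_of_isOrientedConnectedSum_neg_of_cancel_two
    (hK : exists_isMorse_ncard_criticalSetOfIndex_zero_add_one_eq.{0} 2) :
    HomotopySphere.boundsContractible_of_isOrientedConnectedSum_neg :=
  boundsContractible_of_isOrientedConnectedSum_neg_of_two (contractibleSpace_compl_singleton_two hK)

/-- **Lemma 2.4 for every sum from spc4.S24 (b) in dimension `2`** (a closed connected surface
carries a self-indexing Morse function with one critical point of index `0` and one of index
`2`, `exists_isMorse_isSelfIndexing 2`; Milnor 1965, Thm. 4.8 with §8), through
`contractibleSpace_compl_image_ball_of_exists_isSelfIndexing`. [cite: KervaireMilnorAnnals1963, Lemma 2.4 (p. 507)] [cite: MilnorHCobordism1965, Thm. 4.8 and §8] -/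
theorem boundsContractible_of_isOrientedConnectedSum_neg_of_exists_isSelfIndexing_two
    (hS : FourManifolds.exists_isMorse_isSelfIndexing.{0} 2) :
    HomotopySphere.boundsContractible_of_isOrientedConnectedSum_neg :=
  boundsContractible_of_isOrientedConnectedSum_neg_of_compl_image_ball
    (contractibleSpace_compl_image_ball_of_exists_isSelfIndexing hS)

/-- **Lemma 2.4 for every sum from Milnor's First Cancellation Theorem 5.4 on a slab**
(`Cobordism.Milnor1965_firstCancellation_slab`), through
`contractibleSpace_compl_image_ball_of_firstCancellation_slab`. [cite: KervaireMilnorAnnals1963, Lemma 2.4 (p. 507)] [cite: MilnorHCobordism1965, Thm. 5.4] -/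
theorem boundsContractible_of_isOrientedConnectedSum_neg_of_firstCancellation_slab
    (h54 : Cobordism.Milnor1965_firstCancellation_slab.{0}) :
    HomotopySphere.boundsContractible_of_isOrientedConnectedSum_neg :=
  boundsContractible_of_isOrientedConnectedSum_neg_of_compl_image_ball
    (contractibleSpace_compl_image_ball_of_firstCancellation_slab h54)

/-- **Lemma 2.4 for every sum from Assertion 6 of the proof of Milnor's Thm. 5.4** (the model
chart, `Cobordism.Milnor1965_cancellation_modelChart`), through
`contractibleSpace_compl_image_ball_of_modelChart`. [cite: KervaireMilnorAnnals1963, Lemma 2.4 (p. 507)] [cite: MilnorHCobordism1965, proof of Thm. 5.4, Assertion 6] -/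
theorem boundsContractible_of_isOrientedConnectedSum_neg_of_modelChart
    (hE : Cobordism.Milnor1965_cancellation_modelChart.{0}) :
    HomotopySphere.boundsContractible_of_isOrientedConnectedSum_neg :=
  boundsContractible_of_isOrientedConnectedSum_neg_of_compl_image_ball
    (contractibleSpace_compl_image_ball_of_modelChart hE)

/-- **Lemma 2.4 for every sum from the finest current leaf of the tree**: the deformation of the
level diffeomorphism `h` in the general case of Assertion 6 of the proof of Milnor's First
Cancellation Theorem (`Cobordism.Milnor1965_cancellation_levelDeformation`, Milnor 1965, PDF
pp. 31–32 with Thm. 5.6): Assertion 6 is assembled from the aligned charts (proved,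
`Cobordism.Milnor1965_cancellation_alignedCharts_holds`), the general case
(`Cobordism.Milnor1965_cancellation_levelIsotopy_of_deformation hD`) and the gluing of the charts
(proved, `Cobordism.Milnor1965_cancellation_glueCharts_holds`) by
`Cobordism.Milnor1965_cancellation_modelChart_of_parts` (`HCobordismModelChart.lean`; the same
composite as `Cobordism.Milnor1965_cancellation_modelChart_of_levelDeformation` of
`HCobordismTheoremProofs.lean`, not imported here), then `…_of_modelChart`. The discharge
`boundsContractible_of_isOrientedConnectedSum_neg_holds` is this theorem applied to the discharge
of that leaf. [cite: KervaireMilnorAnnals1963, Lemma 2.4 (p. 507)] [cite: MilnorHCobordism1965, proof of Thm. 5.4, Assertion 6 (PDF pp. 31–32)] -/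
theorem boundsContractible_of_isOrientedConnectedSum_neg_of_levelDeformation
    (hD : Cobordism.Milnor1965_cancellation_levelDeformation.{0}) :
    HomotopySphere.boundsContractible_of_isOrientedConnectedSum_neg :=
  boundsContractible_of_isOrientedConnectedSum_neg_of_modelChart
    (Cobordism.Milnor1965_cancellation_modelChart_of_parts
      Cobordism.Milnor1965_cancellation_alignedCharts_holds
      (Cobordism.Milnor1965_cancellation_levelIsotopy_of_deformation hD)
      Cobordism.Milnor1965_cancellation_glueCharts_holds)

/-- **Lemma 2.4 for every sum from `Θ₂ = 0` alone** (`nonemptyDiffeomorphSphere_two`: every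
smooth surface homotopy equivalent to `S²` is diffeomorphic to it; Kervaire–Milnor 1963, p. 507),
through `contractibleSpace_compl_image_ball_of_sphere_two` (Palais' disc theorem in dimension
`2`, the Hurewicz route in dimensions `≥ 3`). [cite: KervaireMilnorAnnals1963, Lemma 2.4 (p. 507) and p. 507 (`Θ₂ = 0`)] -/
theorem boundsContractible_of_isOrientedConnectedSum_neg_of_sphere_two
    (h2 : nonemptyDiffeomorphSphere_two.{0}) :
    HomotopySphere.boundsContractible_of_isOrientedConnectedSum_neg :=
  boundsContractible_of_isOrientedConnectedSum_neg_of_compl_image_ball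
    (contractibleSpace_compl_image_ball_of_sphere_two h2)

/-! ### Downstream: `Σ # (-Σ) ∼ₕ Sⁿ` for `n ≥ 3` from Lemma 2.3 alone -/

/-- **`Σ # (-Σ)` is h-cobordant to `Sⁿ` in dimensions `n ≥ 3`, GIVEN only Lemma 2.3 (`⇐`)**
(`isHCobordant_sphere_of_boundsContractible`: a closed simply connected manifold bounding a
contractible manifold is h-cobordant to the sphere; Kervaire–Milnor 1963, Lemma 2.3, p. 506):
Lemma 2.4 being proved for `n ≥ 3` (`boundsContractible_of_isOrientedConnectedSum_neg_three_le`)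
and the sum being simply connected by Seifert–van Kampen (`simplyConnectedSpace_of_isConnectedSum`),
this is the sentence "By Lemmas 2.3, 2.4, each element of `Θₙ` has an inverse" of the proof of
Theorem 1.1 (p. 507) in every dimension it is used for the group `Θₙ`, `n ≥ 5`; compare
`isHCobordant_sphere_of_isOrientedConnectedSum_neg_of_three_le`, which takes Lemma 2.4 as a
hypothesis. [cite: KervaireMilnorAnnals1963, Lemmas 2.3–2.4 and proof of Thm. 1.1 (pp. 506–507)] -/
theorem isHCobordant_sphere_of_isOrientedConnectedSum_neg_three_le_of_lemma23
    (h23 : isHCobordant_sphere_of_boundsContractible) {n : ℕ} (h3 : 3 ≤ n) (S : HomotopySphere n)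
    (P : Type) [TopologicalSpace P] [T2Space P] [SecondCountableTopology P]
    [ChartedSpace (EuclideanSpace ℝ (Fin n)) P] [IsManifold (𝓡 n) ∞ P] [CompactSpace P]
    (oP : SmoothOrientation (𝓡 n) P) (hP : IsOrientedConnectedSum S.orientation (-S.orientation) oP) :
    Literature.Topology.FourManifolds.IsHCobordant n P
      (Metric.sphere (0 : EuclideanSpace ℝ (Fin (n + 1))) 1) := by
  haveI := simplyConnectedSpace_of_isConnectedSum h3 S S.neg P hP.isConnectedSum
  exact h23 n P (by omega) (boundsContractible_of_isOrientedConnectedSum_neg_three_le h3 S P oP hP)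

end HomotopySphere

end Literature.Topology.FourManifolds
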